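import Summits.ValiantsHypothesis.ValiantsHypothesis.Theorems.SymPencilSingSixClassificationZeroLine
import Summits.ValiantsHypothesis.ValiantsHypothesis.Theorems.SymPencilPerFourJointFamilyTransport
import Summits.ValiantsHypothesis.ValiantsHypothesis.Theorems.SymPencilPerFourCrossKronecker
import Summits.ValiantsHypothesis.ValiantsHypothesis.Theorems.SymPencilPerFourPairingHyperplane
import Summits.ValiantsHypothesis.ValiantsHypothesis.Theorems.SymPencilPerFourLowRankSeven
import Summits.ValiantsHypothesis.ValiantsHypothesis.Theorems.SymPencilPerFourTwoRowCorankTwo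

/-!
# Route `SymPencil` — the V-side of the size-27 cell `(11, 5, 4)`, PORT of val-idea-18's cascade, leaf E (part 1: tools)
# (`--supports` stmt-ValiantsHypothesis-5674 `SdcSuperquadratic`; port of §2b of
# `Cruxes/SdcSuperquadratic/Lines/sing_five_classification.lean` rev 10 (val-idea-18 g5); PORT-PLAN-115.md; rung currency only)

Leaf E of the cascade (memo §5): a `5`-dimensional `W ⊆ W_col(p,q;m)` (only rows `p, q` live, their column `m` dead) with a
per-POINT family of four squares is a torus-type hyperplane `{Σ θ_j x_(q,τ j) = 0}`.  This part: `eval_wcol_point`,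
`live_decomp`, `coeffs_of_adj_identity`, `pureRow_of_symm_prod`, `cellE_apply`, the per-point transport `perPointFour_map'`
and `exists_perm_zero_one`.  Continuations: `SymPencilSingFiveLeafWcolNormal` (`wcolFive01`), `SymPencilSingFiveLeafWcol` (`wcolFive`).

Honest framing: [folklore] a verbatim port (the elementary matrices `cellE p` spelled `Pi.single p 1`); `27 ≤ sdc(per₄) ≤ 29`
unchanged; the crux `SdcSuperquadratic` and `VP ≠ VNP` untouched; no summit statement is proved here.  No definitions, no named facts.
-/

noncomputable section

-- single-conjunct layout: Sub = Summit, duplicated namespace component intended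
set_option linter.dupNamespace false

namespace Summit.ValiantsHypothesis.ValiantsHypothesis.Theorems.SymPencilSingFiveClassification

open MvPolynomial Module Matrix
open scoped Polynomial
open Literature.Computability.AlgebraicComplexity
open Summit.ValiantsHypothesis.ValiantsHypothesis.Theorems
open Summit.ValiantsHypothesis.ValiantsHypothesis.Theorems.SymPencilSingSixClassification
open Summit.ValiantsHypothesis.ValiantsHypothesis.Theorems.SymPencilPerFourJointFamilyTransport

variable {K : Type*} [Field K]

/-- `per₄` at the base point `u = E₂₃ + ν₀E₃₀ + ν₁E₃₁ + ν₂E₃₂` plus `s ·` (an element of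
`W_col(0,1;3)`) is exactly `s² · P_ν(y)`, `P_ν(y) = αᵀ N(ν) β` for the live rows `α, β` … (memo). [folklore] -/
theorem eval_wcol_point (y : Fin 4 × Fin 4 → K) (h2 : ∀ j, y (2, j) = 0) (h3 : ∀ j, y (3, j) = 0)
    (h03 : y (0, 3) = 0) (h13 : y (1, 3) = 0) (ν₀ ν₁ ν₂ : K) (u : Fin 4 × Fin 4 → K)
    (hu : ∀ p, u p = if p = (2, 3) then 1 else if p = (3, 0) then ν₀ else if p = (3, 1) then ν₁
      else if p = (3, 2) then ν₂ else 0) (s : K) :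
    eval (u + s • y) (perPoly (Fin 4) K) = 0 + s * 0 + s ^ 2 *
      (ν₀ * (y (0, 1) * y (1, 2) + y (0, 2) * y (1, 1)) +
        ν₁ * (y (0, 0) * y (1, 2) + y (0, 2) * y (1, 0)) +
        ν₂ * (y (0, 0) * y (1, 1) + y (0, 1) * y (1, 0))) := by
  obtain ⟨f01, f02, f03, f10, f12, f13, f20, f21, f23, f30, f31, f32⟩ :
      (((0 : Fin 4) = 1) = False) ∧ (((0 : Fin 4) = 2) = False) ∧ (((0 : Fin 4) = 3) = False) ∧
      (((1 : Fin 4) = 0) = False) ∧ (((1 : Fin 4) = 2) = False) ∧ (((1 : Fin 4) = 3) = False) ∧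
      (((2 : Fin 4) = 0) = False) ∧ (((2 : Fin 4) = 1) = False) ∧ (((2 : Fin 4) = 3) = False) ∧
      (((3 : Fin 4) = 0) = False) ∧ (((3 : Fin 4) = 1) = False) ∧ (((3 : Fin 4) = 2) = False) := by
    refine ⟨?_, ?_, ?_, ?_, ?_, ?_, ?_, ?_, ?_, ?_, ?_, ?_⟩ <;> decide
  have y20 := h2 0; have y21 := h2 1; have y22 := h2 2; have y23 := h2 3
  have y30 := h3 0; have y31 := h3 1; have y32 := h3 2; have y33 := h3 3
  rw [eval_perPoly, Matrix.permanent_fin_four_row]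
  simp only [Matrix.of_apply, Pi.add_apply, Pi.smul_apply, smul_eq_mul, hu, Prod.mk.injEq,
    f01, f02, f03, f10, f12, f13, f20, f21, f23, f30, f31, f32, and_true, and_false, if_true,
    if_false, y20, y21, y22, y23, y30, y31, y32, y33, h03, h13]
  ring

/-- Decomposition of a live vector of `W_col(0,1;3)` into the six live cells. [folklore] -/
theorem live_decomp (x : Fin 4 × Fin 4 → K) (h2 : ∀ j, x (2, j) = 0) (h3 : ∀ j, x (3, j) = 0)
    (h03 : x (0, 3) = 0) (h13 : x (1, 3) = 0) :
    x = x (0, 0) • (Pi.single ((0 : Fin 4), (0 : Fin 4)) (1 : K) : Fin 4 × Fin 4 → K) +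
      x (0, 1) • (Pi.single ((0 : Fin 4), (1 : Fin 4)) (1 : K) : Fin 4 × Fin 4 → K) +
      x (0, 2) • (Pi.single ((0 : Fin 4), (2 : Fin 4)) (1 : K) : Fin 4 × Fin 4 → K) +
      x (1, 0) • (Pi.single ((1 : Fin 4), (0 : Fin 4)) (1 : K) : Fin 4 × Fin 4 → K) +
      x (1, 1) • (Pi.single ((1 : Fin 4), (1 : Fin 4)) (1 : K) : Fin 4 × Fin 4 → K) +
      x (1, 2) • (Pi.single ((1 : Fin 4), (2 : Fin 4)) (1 : K) : Fin 4 × Fin 4 → K) := by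
  have y20 := h2 0; have y21 := h2 1; have y22 := h2 2; have y23 := h2 3
  have y30 := h3 0; have y31 := h3 1; have y32 := h3 2; have y33 := h3 3
  ext ⟨i, j⟩
  fin_cases i <;> fin_cases j <;> simp [y20, y21, y22, y23, y30, y31, y32, y33, h03, h13]

/-- Coefficients of the adjugate identity `φ₀ᵀ adj N(ν) φ₁ = 0` on the torus: seven evaluations
kill the quadratic in `ν`. [folklore] -/
theorem coeffs_of_adj_identity [CharZero K] {A0 A1 A2 S01 S02 S12 : K}
    (hF : ∀ ν₀ ν₁ ν₂ : K, ν₀ * ν₁ * ν₂ ≠ 0 →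
      -(ν₀ ^ 2 * A0) - ν₁ ^ 2 * A1 - ν₂ ^ 2 * A2 + ν₀ * ν₁ * S01 + ν₀ * ν₂ * S02 +
        ν₁ * ν₂ * S12 = 0) :
    A0 = 0 ∧ A1 = 0 ∧ A2 = 0 ∧ S01 = 0 ∧ S02 = 0 ∧ S12 = 0 := by
  have h2 : (2 : K) ≠ 0 := two_ne_zero
  have hm1 : (-1 : K) ≠ 0 := by norm_num
  have g1 := hF 1 1 1 (by norm_num)
  have g2 := hF (-1) 1 1 (by norm_num)
  have g3 := hF 1 (-1) 1 (by norm_num)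
  have g4 := hF 1 1 (-1) (by norm_num)
  have g5 := hF 2 1 1 (by norm_num)
  have g6 := hF 1 2 1 (by norm_num)
  have g7 := hF 1 1 2 (by norm_num)
  have hS01 : S01 = 0 := by linear_combination (g1 - g2 - g3 + g4) / 4
  have hS02 : S02 = 0 := by linear_combination (g1 - g2 + g3 - g4) / 4
  have hS12 : S12 = 0 := by linear_combination (g1 + g2 - g3 - g4) / 4
  have hA0 : A0 = 0 := by linear_combination (3 * g1 - g2 - 2 * g5) / 6
  have hA1 : A1 = 0 := by linear_combination (3 * g1 - g3 - 2 * g6) / 6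
  have hA2 : A2 = 0 := by linear_combination (3 * g1 - g4 - 2 * g7) / 6
  exact ⟨hA0, hA1, hA2, hS01, hS02, hS12⟩

/-- `φ₀ ⊗ φ₁ + φ₁ ⊗ φ₀ = 0` forces `φ₀ = 0 ∨ φ₁ = 0`. [folklore] -/
theorem pureRow_of_symm_prod {φ00 φ01 φ02 φ10 φ11 φ12 : K}
    (hA0 : φ00 * φ10 = 0) (hA1 : φ01 * φ11 = 0) (hA2 : φ02 * φ12 = 0)
    (hS01 : φ00 * φ11 + φ01 * φ10 = 0) (hS02 : φ00 * φ12 + φ02 * φ10 = 0)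
    (hS12 : φ01 * φ12 + φ02 * φ11 = 0) :
    (φ00 = 0 ∧ φ01 = 0 ∧ φ02 = 0) ∨ (φ10 = 0 ∧ φ11 = 0 ∧ φ12 = 0) := by
  by_cases h00 : φ00 = 0
  · by_cases h01 : φ01 = 0
    · by_cases h02 : φ02 = 0
      · exact Or.inl ⟨h00, h01, h02⟩
      · right
        have h12 : φ12 = 0 := (mul_eq_zero.1 hA2).resolve_left h02
        have h10 : φ10 = 0 := by
          have : φ02 * φ10 = 0 := by linear_combination hS02 - φ12 * h00
          exact (mul_eq_zero.1 this).resolve_left h02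
        have h11 : φ11 = 0 := by
          have : φ02 * φ11 = 0 := by linear_combination hS12 - φ12 * h01
          exact (mul_eq_zero.1 this).resolve_left h02
        exact ⟨h10, h11, h12⟩
    · right
      have h11 : φ11 = 0 := (mul_eq_zero.1 hA1).resolve_left h01
      have h10 : φ10 = 0 := by
        have : φ01 * φ10 = 0 := by linear_combination hS01 - φ11 * h00
        exact (mul_eq_zero.1 this).resolve_left h01
      have h12 : φ12 = 0 := by
        have : φ01 * φ12 = 0 := by linear_combination hS12 - φ02 * h11
        exact (mul_eq_zero.1 this).resolve_left h01
      exact ⟨h10, h11, h12⟩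
  · right
    have h10 : φ10 = 0 := (mul_eq_zero.1 hA0).resolve_left h00
    have h11 : φ11 = 0 := by
      have : φ00 * φ11 = 0 := by linear_combination hS01 - φ01 * h10
      exact (mul_eq_zero.1 this).resolve_left h00
    have h12 : φ12 = 0 := by
      have : φ00 * φ12 = 0 := by linear_combination hS02 - φ02 * h10
      exact (mul_eq_zero.1 this).resolve_left h00
    exact ⟨h10, h11, h12⟩

/-- The elementary matrix `E_p` of a cell `p`, evaluated. [folklore] -/
theorem cellE_apply (p q : Fin 4 × Fin 4) :
    (Pi.single p (1 : K) : Fin 4 × Fin 4 → K) q = if q = p then 1 else 0 := by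
  simp only [Pi.single_apply]

/-- Transport of a per-point family of four squares along a `per₄`-preserving linear
equivalence. [folklore] -/
theorem perPointFour_map' (W : Submodule K (Fin 4 × Fin 4 → K))
    (Φ : (Fin 4 × Fin 4 → K) ≃ₗ[K] (Fin 4 × Fin 4 → K))
    (hΦ : ∀ z, eval (Φ z) (perPoly (Fin 4) K) = eval z (perPoly (Fin 4) K))
    (hP : ∀ u : Fin 4 × Fin 4 → K, ∃ (c : Fin 4 → K) (Λ : Fin 4 → ((Fin 4 × Fin 4 → K) →ₗ[K] K)),
      ∀ y ∈ W, ∃ e₀ e₁ : K, ∀ s : K,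
        eval (u + s • y) (perPoly (Fin 4) K) = e₀ + s * e₁ + s ^ 2 * ∑ k, c k * (Λ k y) ^ 2) :
    ∀ u : Fin 4 × Fin 4 → K, ∃ (c : Fin 4 → K) (Λ : Fin 4 → ((Fin 4 × Fin 4 → K) →ₗ[K] K)),
      ∀ y ∈ W.map Φ.toLinearMap, ∃ e₀ e₁ : K, ∀ s : K,
        eval (u + s • y) (perPoly (Fin 4) K) = e₀ + s * e₁ + s ^ 2 * ∑ k, c k * (Λ k y) ^ 2 := by
  intro u'
  obtain ⟨c, Λ, h⟩ := hP (Φ.symm u')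
  refine ⟨c, fun k => (Λ k).comp Φ.symm.toLinearMap, ?_⟩
  rintro _ ⟨y, hy, rfl⟩
  obtain ⟨e₀, e₁, he⟩ := h y hy
  refine ⟨e₀, e₁, fun s => ?_⟩
  have hu : u' + s • Φ.toLinearMap y = Φ (Φ.symm u' + s • y) := by
    rw [map_add, map_smul, LinearEquiv.apply_symm_apply]
    rfl
  rw [hu, hΦ, he s]
  simp only [LinearMap.coe_comp, LinearEquiv.coe_coe, Function.comp_apply,
    LinearEquiv.symm_apply_apply]

/-- Two-point transitivity of `S₄` (rows `0, 1`). [folklore] -/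
theorem exists_perm_zero_one : ∀ p q : Fin 4, p ≠ q →
    ∃ σ : Equiv.Perm (Fin 4), σ 0 = p ∧ σ 1 = q := by
  decide

end Summit.ValiantsHypothesis.ValiantsHypothesis.Theorems.SymPencilSingFiveClassification
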